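import Summits.BirchSwinnertonDyer.Rank1Residual.GaloisImage.RamifiedOrdinaryLineTwist
import Summits.BirchSwinnertonDyer.Rank1Residual.X2.GreenbergVatsalStrictAtPQuotient
import Literature.NumberTheory.EllipticCurves.DiscreteH1Equiv
import HarnessLib

/-!
# Transport of Greenberg's local conditions (`strictKer`, `greenbergKer`) along an equivariant
# isomorphism of discrete modules carrying `M⁺_v` to `M'⁺_v` — the GREENBERG side of the twist
# transport `E^{(c)} ↔ E` (cell `b2b-bsdres`, team n1011, row T-RD-Δ-K, kernel half of r2's ROUTE-2
# §II.15.3 ARM δ; lead R5-40 (b); seat n1011-p05 gen 3; cc-typer-2's transport item T1)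

HONEST FRAMING (cell `b2b-bsdres`, run/shared/lean/b2b/bsd-rank1-residual/, verbatim in every
file): the goal of the cell is to DELETE the COMBINATION-SHAPED residual classes of the
Birch–Swinnerton-Dyer formula for ALL analytic-rank `≤ 1` elliptic curves over `ℚ` — "full BSD
formula for every rank `≤ 1` curve in class `C`" assembled STRICTLY from published theorems — so
that the rank-`≤ 1` remainder becomes exactly the CONSTRUCTION-SHAPED classes, which are TYPED
(missing-input `Prop`s), NOT attempted. This is not "finishing BSD". Team n1011 (X4 ∧ `p = 3`,
§I N10/N11; ROUTE-2 of planner r2): research route; TOOL theorems of Galois cohomology only; no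
definition, no named fact; nothing booked; no label changes.

## What and why

cc-typer-2 typed Greenberg's Prop. 2.4 (LNM 1716) for the GOOD ORDINARY curve `V` at the level
`ker κ ⊓ Gal(ℚ̄/F)` in STRICT currency (p262636). The additive rows of ARM δ are `E = C • V^{(c)}`
with local datum `twistMap L_V t` (p10's `RamifiedOrdinaryLineTwist.twistMap`, `t` the twist
transport). To move the typed inclusion `L_V.strictKer H ≤ V.localKerOver p H ℚ_v` to `E` one needs,
at a level `H ≤ galRange ℚ(√c)` where `t` is `H`-equivariant, that BOTH local conditions correspond
under the induced `H¹`-isomorphism `h1Equiv t`. The Kummer side is additive-p1's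
`TwistTransportLocal.mem_localKerOver_iff_twist`; this file is the Greenberg side, GENERIC:

* §1 **`mem_strictKer_iff_h1Equiv_mem`** / **`mem_greenbergKer_iff_h1Equiv_mem`** — for any number
  field `K`, `H ≤ Γ_K`, discrete `Γ_K`-modules `M, M'`, data `N, N'` at `v` and an `H`-equivariant
  `θ : M ≃+ M'` with `θ m ∈ N'.plus ↔ m ∈ N.plus`:
  `c ∈ N.strictKer H ↔ h1Equiv θ c ∈ N'.strictKer H` (and the same for `greenbergKer`) — the tree's
  square lemma `mem_resKer_iff_h1Equiv_mem` with the induced `M/M⁺_v ≃+ M'/M'⁺_v`;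
* §2 the instance `N' = twistMap N θ` (`…_twistMap`), and **`smul_grMk_twistMap_eq_neg`**: an
  element of `D_v` at which `θ` is ANTI-equivariant and which acts trivially on `M/M⁺_v` acts as `−1`
  on `M'/M'⁺_v` — the input of `GreenbergStrictOfNoInertiaInvariants.forall_fixed_eq_zero_of_smul_eq_neg`;
* §3 (`K = ℚ`, cyclotomic `κ`, `p ≠ 2`) **`exists_inertiaIn_kerSubgroup_map_smul_eq_neg`**: for ANY
  `t` equivariant on `galRange ℚ(√c)` and anti-equivariant at one element of `I_{ℚ_v}`, an element of
  `I_v ∩ Gal(ℚ̄/ℚ_∞)` at which `t` is anti-equivariant (the witness raised to the odd power `p^B` and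
  corrected into `ker κ` by X2's "inertia fills every layer", `exists_layer_le_kappa_inertia`,
  applied to `galRange K`); instance `…_twistTransport_…` for p10's `twistTransport` (`ord_v c = 1`,
  p10's `exists_mem_absInertia_twistTransport_smul_eq_neg`).

References: [GreenbergLNM1716] §2 pp. 73–75; [Greenberg1989] §1 p. 98; [SilvermanAEC2009] X.5
Cor. 5.4; [SerreGaloisCohomology1997] I.§2.4.
-/

noncomputable section

open scoped Classical

universe u

namespace Summit.BirchSwinnertonDyer.Rank1Residual.GaloisImage

open NumberField IsDedekindDomain Field Literature.NumberTheory.GaloisRepresentations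
  Literature.NumberTheory.EllipticCurves Literature.NumberTheory.EllipticCurves.GreenbergSelmer
  Summit.BirchSwinnertonDyer.Rank1Residual.GaloisImage.RamifiedOrdinaryLineTwist

/-! ## §1 Generic transport of `strictKer` / `greenbergKer` -/

section Generic

variable {K : Type u} [Field K] [NumberField K] (H : Subgroup (absoluteGaloisGroup K))
  {M M' : Type u} [AddCommGroup M] [AddCommGroup M']
  [DistribMulAction (absoluteGaloisGroup K) M] [DistribMulAction (absoluteGaloisGroup K) M']
  {v : HeightOneSpectrum (𝓞 K)} (N : LocalDatum K M v) (N' : LocalDatum K M' v)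
  (θ : M ≃+ M')

/-- `θ(M⁺_v) = M'⁺_v` when `θ m ∈ M'⁺_v ↔ m ∈ M⁺_v`. [folklore] -/
theorem map_plus_eq_of_iff (hplus : ∀ m : M, θ m ∈ N'.plus ↔ m ∈ N.plus) :
    N.plus.map (θ : M →+ M') = N'.plus := by
  ext m'
  constructor
  · rintro ⟨m, hm, rfl⟩
    exact (hplus m).2 hm
  · intro hm'
    refine ⟨θ.symm m', (hplus _).1 ?_, ?_⟩
    · rw [AddEquiv.apply_symm_apply]; exact hm'
    · change θ (θ.symm m') = m'
      exact AddEquiv.apply_symm_apply θ m'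

/-- An isomorphism `M/M⁺_v ≃+ M'/M'⁺_v` over `θ` is `D_v`-equivariant wherever `θ` is: for
`x ∈ D_v` with `θ (x • m) = x • θ m` for all `m`. [folklore] -/
theorem smul_of_grMk_sq (θN : N.Gr ≃+ N'.Gr) (hsq : ∀ m : M, N'.grMk (θ m) = θN (N.grMk m))
    (x : decomp (K := K) v)
    (hx : ∀ m : M, θ ((x : absoluteGaloisGroup K) • m) = (x : absoluteGaloisGroup K) • θ m)
    (n : N.Gr) : θN (x • n) = x • θN n := by
  obtain ⟨m, rfl⟩ := N.grMk_surjective n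
  rw [LocalDatum.smul_grMk, ← hsq, ← hsq, LocalDatum.smul_grMk, hx]

variable [TopologicalSpace M] [DiscreteTopology M] [TopologicalSpace M'] [DiscreteTopology M']
  (hθ : ∀ (g : H) (m : M), θ (g • m) = g • θ m)
  (hplus : ∀ m : M, θ m ∈ N'.plus ↔ m ∈ N.plus)

include hplus

/-- **Transport of the STRICT condition.** For an `H`-equivariant isomorphism `θ : M ≃+ M'` of
discrete `Γ_K`-modules with `θ m ∈ M'⁺_v ↔ m ∈ M⁺_v`, a class `c ∈ H¹(H, M)` satisfies the strict
condition for `N` iff `θ_* c` does for `N'`. [cite: Greenberg1989, §1 p. 98]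
[cite: SerreGaloisCohomology1997, I.§2.4] -/
theorem mem_strictKer_iff_h1Equiv_mem (c : subgroupH1 H M) :
    c ∈ N.strictKer H ↔ h1Equiv (G := H) θ hθ c ∈ N'.strictKer H := by
  have hmap := map_plus_eq_of_iff N N' θ hplus
  set θN : N.Gr ≃+ N'.Gr := QuotientAddGroup.congr N.plus N'.plus θ hmap with hθN
  have hsq : ∀ m : M, N'.grMk (θ m) = θN (N.grMk m) := fun _ ↦ rfl
  have hθNeq : ∀ (x : decompIn H v) (n : N.Gr), θN (x • n) = x • θN n := fun x n ↦
    smul_of_grMk_sq N N' θ θN hsq (x : decomp (K := K) v) (fun m ↦ hθ (decompInToH H v x) m) n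
  rw [LocalDatum.strictKer, LocalDatum.strictKer, LocalDatum.strictMap, LocalDatum.strictMap,
    ← resKer_eq_ker, ← resKer_eq_ker]
  exact mem_resKer_iff_h1Equiv_mem (decompInToH H v) N.grMk _ N'.grMk _ θ hθ θN hθNeq hsq c

/-- **Transport of GREENBERG's (inertia) condition**, same hypotheses.
[cite: Greenberg1989, §1 p. 98 (4)] [cite: SerreGaloisCohomology1997, I.§2.4] -/
theorem mem_greenbergKer_iff_h1Equiv_mem (c : subgroupH1 H M) :
    c ∈ N.greenbergKer H ↔ h1Equiv (G := H) θ hθ c ∈ N'.greenbergKer H := by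
  have hmap := map_plus_eq_of_iff N N' θ hplus
  set θN : N.Gr ≃+ N'.Gr := QuotientAddGroup.congr N.plus N'.plus θ hmap with hθN
  have hsq : ∀ m : M, N'.grMk (θ m) = θN (N.grMk m) := fun _ ↦ rfl
  have hθNeq : ∀ (x : inertiaIn H v) (n : N.Gr), θN (x • n) = x • θN n := fun x n ↦
    smul_of_grMk_sq N N' θ θN hsq (x : decomp (K := K) v) (fun m ↦ hθ (inertiaInToH H v x) m) n
  rw [LocalDatum.greenbergKer, LocalDatum.greenbergKer, LocalDatum.greenbergMap,
    LocalDatum.greenbergMap, ← resKer_eq_ker, ← resKer_eq_ker]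
  exact mem_resKer_iff_h1Equiv_mem (inertiaInToH H v) N.grMk _ N'.grMk _ θ hθ θN hθNeq hsq c

/-- Subgroup form: `θ_* (N.strictKer H) = N'.strictKer H`. [cite: Greenberg1989, §1 p. 98] -/
theorem map_strictKer_h1Equiv :
    (N.strictKer H).map (h1Equiv (G := H) θ hθ).toAddMonoidHom = N'.strictKer H := by
  ext c'
  constructor
  · rintro ⟨c, hc, rfl⟩
    exact (mem_strictKer_iff_h1Equiv_mem H N N' θ hθ hplus c).1 hc
  · intro hc'
    refine ⟨(h1Equiv (G := H) θ hθ).symm c', ?_, ?_⟩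
    · rw [SetLike.mem_coe, mem_strictKer_iff_h1Equiv_mem H N N' θ hθ hplus,
        AddEquiv.apply_symm_apply]
      exact hc'
    · exact AddEquiv.apply_symm_apply _ c'

end Generic

/-! ## §2 The instance `N' = twistMap N θ` and the sign on the quotient -/

section Twist

variable {K : Type u} [Field K] [NumberField K] (H : Subgroup (absoluteGaloisGroup K))
  {M M' : Type u} [AddCommGroup M] [AddCommGroup M']
  [DistribMulAction (absoluteGaloisGroup K) M] [DistribMulAction (absoluteGaloisGroup K) M']
  [TopologicalSpace M] [DiscreteTopology M] [TopologicalSpace M'] [DiscreteTopology M']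
  {v : HeightOneSpectrum (𝓞 K)} (N : LocalDatum K M v) (θ : M ≃+ M')
  (hsign : ∀ g : absoluteGaloisGroup K, (∀ m, θ (g • m) = g • θ m) ∨ (∀ m, θ (g • m) = -(g • θ m)))
  (hθ : ∀ (g : H) (m : M), θ (g • m) = g • θ m)

/-- **Strict condition under the twist transport of a datum**: `c ∈ N.strictKer H` iff
`θ_* c ∈ (twistMap N θ).strictKer H`, for `θ` `H`-equivariant (e.g. `H ≤ galRange K(√c)`).
[cite: GreenbergLNM1716, §2 pp. 73–75] [cite: SilvermanAEC2009, X.5 Cor. 5.4] -/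
theorem mem_strictKer_iff_h1Equiv_mem_twistMap (c : subgroupH1 H M) :
    c ∈ N.strictKer H ↔ h1Equiv (G := H) θ hθ c ∈ (twistMap N θ hsign).strictKer H :=
  mem_strictKer_iff_h1Equiv_mem H N _ θ hθ (fun m ↦ apply_mem_twistMap_plus_iff N θ hsign m) c

/-- **Greenberg's condition under the twist transport of a datum.**
[cite: GreenbergLNM1716, §2 pp. 73–75] [cite: SilvermanAEC2009, X.5 Cor. 5.4] -/
theorem mem_greenbergKer_iff_h1Equiv_mem_twistMap (c : subgroupH1 H M) :
    c ∈ N.greenbergKer H ↔ h1Equiv (G := H) θ hθ c ∈ (twistMap N θ hsign).greenbergKer H :=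
  mem_greenbergKer_iff_h1Equiv_mem H N _ θ hθ (fun m ↦ apply_mem_twistMap_plus_iff N θ hsign m) c

/-- `θ_* (N.strictKer H) = (twistMap N θ).strictKer H`. [cite: GreenbergLNM1716, §2 pp. 73–75] -/
theorem map_strictKer_h1Equiv_twistMap :
    (N.strictKer H).map (h1Equiv (G := H) θ hθ).toAddMonoidHom = (twistMap N θ hsign).strictKer H :=
  map_strictKer_h1Equiv H N _ θ hθ (fun m ↦ apply_mem_twistMap_plus_iff N θ hsign m)

omit [TopologicalSpace M] [DiscreteTopology M] [TopologicalSpace M'] [DiscreteTopology M'] in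
/-- **The sign on the quotient.** If `x ∈ D_v` acts trivially on `M/M⁺_v` (e.g. an inertial element on
the unramified quotient `Ẽ_V[p^∞]` of the good ordinary datum) and `θ` is ANTI-equivariant at `x`
(the twist transport off `galRange K(√c)`), then `x` acts as `−1` on the quotient of the transported
datum: `x • d' = -d'` on `M'/θ(M⁺_v)` ("`Ẽ_V[p^∞] ⊗ χ_c`"). [cite: SilvermanAEC2009, X.5 Cor. 5.4]
[cite: GreenbergLNM1716, §2 p. 73] -/
theorem smul_eq_neg_twistMap_gr (x : decomp (K := K) v)
    (hanti : ∀ m : M, θ ((x : absoluteGaloisGroup K) • m) = -((x : absoluteGaloisGroup K) • θ m))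
    (htriv : ∀ d : N.Gr, x • d = d) (d' : (twistMap N θ hsign).Gr) : x • d' = -d' := by
  obtain ⟨m', rfl⟩ := (twistMap N θ hsign).grMk_surjective d'
  obtain ⟨m, rfl⟩ := θ.surjective m'
  have h1 : (x : absoluteGaloisGroup K) • θ m = -θ ((x : absoluteGaloisGroup K) • m) := by
    rw [hanti, neg_neg]
  rw [LocalDatum.smul_grMk, h1, map_neg, neg_inj]
  -- `θ (x • m) ≡ θ m (mod θ(M⁺_v))` since `x • m ≡ m (mod M⁺_v)`
  have h2 : N.grMk ((x : absoluteGaloisGroup K) • m) = N.grMk m := by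
    rw [← LocalDatum.smul_grMk]; exact htriv _
  rw [← AddMonoidHom.sub_mem_ker_iff, LocalDatum.ker_grMk] at h2 ⊢
  rw [← map_sub]
  exact (apply_mem_twistMap_plus_iff N θ hsign _).2 h2

end Twist

/-! ## §3 Over `ℚ`: an inertial element of `Gal(ℚ̄/ℚ_∞)` at which the twist transport is
anti-equivariant -/

section Rat

open Summit.BirchSwinnertonDyer.Rank1Residual.X2.GreenbergVatsalStrictAtPQuotient

variable (K : Type) [Field K] [NumberField K] (h2 : Module.finrank ℚ K = 2) {θ : K} {c : ℚ}
  (hθ : θ ∉ Set.range (algebraMap ℚ K)) (hc : θ ^ 2 = algebraMap ℚ K c) (p : ℕ) [Fact p.Prime]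
  {M M' : Type} [AddCommGroup M] [AddCommGroup M']
  [DistribMulAction (absoluteGaloisGroup ℚ) M] [DistribMulAction (absoluteGaloisGroup ℚ) M']
  (t : M ≃+ M') (κ : ZpExtension ℚ p) {v : HeightOneSpectrum (𝓞 ℚ)}

omit [NumberField K] [Fact p.Prime] in
/-- Anti-equivariance at `g` propagates to `g ^ (2 n + 1)`. [folklore] -/
theorem map_smul_pow_odd_of_anti {g : absoluteGaloisGroup ℚ} (hg : ∀ m, t (g • m) = -(g • t m))
    (n : ℕ) (m : M) : t (g ^ (2 * n + 1) • m) = -(g ^ (2 * n + 1) • t m) := by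
  induction n generalizing m with
  | zero => simpa using hg m
  | succ n ih =>
    have e : g ^ (2 * (n + 1) + 1) = g * g * g ^ (2 * n + 1) := by
      rw [show 2 * (n + 1) + 1 = 1 + 1 + (2 * n + 1) by ring, pow_add, pow_add, pow_one]
    rw [e, mul_smul, mul_smul, hg, hg, ih, mul_smul, mul_smul]
    simp only [smul_neg, neg_neg]

include h2 hθ hc in
/-- **A ramified inertia witness inside `Gal(ℚ̄/ℚ_∞)`.** Let `κ` be the cyclotomic `ℤ_p`-extension,
`p ≠ 2`, `p ∈ v`, `K = ℚ(θ)`, `θ² = c`, and `t : M ≃+ M'` an additive isomorphism of `Γ_ℚ`-modules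
that is equivariant on `galRange K = Gal(ℚ̄/K)` and ANTI-equivariant at some element of the local
inertia group `I_{ℚ_v}` (p10's `exists_mem_absInertia_twistTransport_smul_eq_neg` for the twist
transport when `ord_v c = 1`). Then `t` is anti-equivariant at some element `τ` of `I_v ∩ ker κ` —
the inertia group of `ℚ_∞` at the prime above `p` acts on `M' = M ⊗ χ_c` through `χ_c(τ) = −1`.
(The witness raised to the odd power `p^B` and corrected by an element of `I_v ∩ Gal(ℚ̄/K)` with the
same `κ`-value, which exists because inertia fills every layer of the totally ramified tower
`ℚ_∞/ℚ` — X2's `exists_layer_le_kappa_inertia`.) [cite: SerreInventiones1972, §1.3]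
[cite: GreenbergLNM1716, §2 p. 73] -/
theorem exists_inertiaIn_kerSubgroup_map_smul_eq_neg (hκ : κ.IsCyclotomic) (hp2 : p ≠ 2)
    (hv : ((p : ℕ) : 𝓞 ℚ) ∈ v.asIdeal)
    (ht : ∀ g ∈ galRange (K := ℚ) K, ∀ m, t (g • m) = g • t m)
    (hanti : ∃ σ ∈ absInertia (v.adicCompletion ℚ), ∀ m,
      t (absGaloisRestrict ℚ (v.adicCompletion ℚ) σ • m) =
        -(absGaloisRestrict ℚ (v.adicCompletion ℚ) σ • t m)) :
    ∃ τ : inertiaIn κ.kerSubgroup v, ∀ m : M,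
      t (((τ : decomp (K := ℚ) v) : absoluteGaloisGroup ℚ) • m) =
        -(((τ : decomp (K := ℚ) v) : absoluteGaloisGroup ℚ) • t m) := by
  haveI : IsGalois ℚ K := isGalois_of_finrank_eq_two K h2
  obtain ⟨σ, hσI, hσ⟩ := hanti
  set g : absoluteGaloisGroup ℚ := absGaloisRestrict ℚ (v.adicCompletion ℚ) σ with hg
  have hgD : g ∈ decomp v := ⟨σ, rfl⟩
  have hgI : g ∈ inertia v := Subgroup.mem_map.2 ⟨σ, hσI, rfl⟩
  -- the open normal subgroup `galRange K ∩ D_v` of `D_v`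
  set U : Subgroup (decomp (K := ℚ) v) := (galRange (K := ℚ) K).subgroupOf (decomp v) with hU
  haveI : (galRange (K := ℚ) K).Normal := normal_galRange K h2 (sigmaQ_ne_one K h2 hθ hc)
  haveI : U.Normal := by rw [hU]; infer_instance
  have hUo : IsOpen (U : Set (decomp (K := ℚ) v)) :=
    (isOpen_galRange K).preimage continuous_subtype_val
  obtain ⟨B, hB⟩ := exists_layer_le_kappa_inertia κ v hκ hv U hUo
  -- `u = g ^ (p ^ B)` has `κ`-value divisible by `p ^ B`
  set u : decomp (K := ℚ) v := ⟨g, hgD⟩ ^ (p ^ B) with hu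
  have hκu : (p : ℤ_[p]) ^ B ∣ (κ (u : absoluteGaloisGroup ℚ)).toAdd := by
    rw [hu, SubgroupClass.coe_pow, map_pow, toAdd_pow, nsmul_eq_mul]
    push_cast
    exact Dvd.intro _ rfl
  obtain ⟨w, hwU, hwI, hκw⟩ := hB u hκu
  -- `τ = u * w⁻¹`
  have hτker : ((u * w⁻¹ : decomp (K := ℚ) v) : absoluteGaloisGroup ℚ) ∈ κ.kerSubgroup := by
    rw [ZpExtension.mem_kerSubgroup, Subgroup.coe_mul, Subgroup.coe_inv, map_mul, map_inv, hκw,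
      mul_inv_cancel]
  have hτI : ((u * w⁻¹ : decomp (K := ℚ) v) : absoluteGaloisGroup ℚ) ∈ inertia v := by
    rw [Subgroup.coe_mul, Subgroup.coe_inv]
    refine (inertia v).mul_mem ?_ ((inertia v).inv_mem hwI)
    rw [hu, SubgroupClass.coe_pow]
    exact (inertia v).pow_mem hgI _
  refine ⟨⟨u * w⁻¹, (mem_inertiaIn_iff κ.kerSubgroup v _).2 ⟨hτker, hτI⟩⟩, fun m ↦ ?_⟩
  change t (((u * w⁻¹ : decomp (K := ℚ) v) : absoluteGaloisGroup ℚ) • m) =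
    -(((u * w⁻¹ : decomp (K := ℚ) v) : absoluteGaloisGroup ℚ) • t m)
  have hwK : ((w⁻¹ : decomp (K := ℚ) v) : absoluteGaloisGroup ℚ) ∈ galRange (K := ℚ) K := by
    rw [Subgroup.coe_inv]
    exact (galRange (K := ℚ) K).inv_mem (Subgroup.mem_subgroupOf.1 hwU)
  -- `p ^ B` is odd
  obtain ⟨n, hn⟩ : ∃ n, p ^ B = 2 * n + 1 := by
    have hodd : Odd (p ^ B) := Odd.pow ((Fact.out : p.Prime).odd_of_ne_two hp2)
    obtain ⟨n, hn⟩ := hodd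
    exact ⟨n, hn⟩
  rw [Subgroup.coe_mul, mul_smul, mul_smul, hu, SubgroupClass.coe_pow, Subgroup.coe_mk, hn,
    map_smul_pow_odd_of_anti t hσ n, ht _ hwK]

include h2 in
/-- **The instance for p10's twist transport** `twistTransport V K hθ hc p hC : V[p^∞] ≃+ W[p^∞]`
(`W = C • V^{(c)}`, `ord_v c = 1`): an element of `I_v ∩ ker κ` at which it is anti-equivariant
(`twistTransport_smul_of_mem_galRange`, `exists_mem_absInertia_twistTransport_smul_eq_neg`).
[cite: SerreInventiones1972, §1.3] [cite: SilvermanAEC2009, X.5 Cor. 5.4] -/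
theorem exists_inertiaIn_kerSubgroup_twistTransport_smul_eq_neg (V : WeierstrassCurve ℚ)
    {W : WeierstrassCurve ℚ} {C : WeierstrassCurve.VariableChange ℚ} (hC : C • V.quadraticTwist c = W)
    (hκ : κ.IsCyclotomic) (hp2 : p ≠ 2) (hv : ((p : ℕ) : 𝓞 ℚ) ∈ v.asIdeal)
    (hval : v.valuation ℚ c = WithZero.exp (-1 : ℤ)) :
    ∃ τ : inertiaIn κ.kerSubgroup v, ∀ m : V.geomPrimaryTorsion p,
      twistTransport V K hθ hc p hC (((τ : decomp (K := ℚ) v) : absoluteGaloisGroup ℚ) • m) =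
        -(((τ : decomp (K := ℚ) v) : absoluteGaloisGroup ℚ) • twistTransport V K hθ hc p hC m) :=
  exists_inertiaIn_kerSubgroup_map_smul_eq_neg K h2 hθ hc p (twistTransport V K hθ hc p hC) κ hκ hp2 hv
    (fun _ hg m ↦ twistTransport_smul_of_mem_galRange V K hθ hc p hC hg m)
    (exists_mem_absInertia_twistTransport_smul_eq_neg V K h2 hθ hc p hC hp2 hv hval)

end Rat

end Summit.BirchSwinnertonDyer.Rank1Residual.GaloisImage

end
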